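import Summits.QuantumFields.GaugeBoot.BootstrapFunctionals
import Summits.QuantumFields.GaugeBoot.AbelianPolynomialLoopEquations
import HarnessLib

/-!
# The abelian bootstrap with Wilson-loop test functions only: `U(1)` loop equations + positivity determine every gauge-invariant expectation (gauge-boot, L1 supplement)

HONEST FRAMING (cell `pub-gaugeboot`, page 1 of every file): the venture produces certified bounds
on lattice expectations at stated coupling, gauge group, dimension and torus size; NOT a mass gap,
NOT a continuum limit, NOT a string tension; NOT Yang–Mills-summit-bearing (barriers
`FixedCouplingUltralocality`, `PerturbativeInvisibility`). Structural; it certifies no number.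

## Content

`BootstrapFunctionals.lean` writes the loop equations for ALL polynomial test functions (open
strings included). A Wilson-loop bootstrap à la Li–Zhou (arXiv:2404.17071) writes them only for
GAUGE-INVARIANT test functions. For compact `U(1)` this restricted system is still complete in the
gauge-invariant sector (lean3 gen 73, `AbelianPolynomialLoopEquations`: central directions commute
with gauge transformations), and with positivity the realisability hypothesis disappears:

* `IsSDFunctionalOn Q` — Schwinger–Dyson identities as linear relations, asked only for polynomial
  test functions satisfying `Q`; `isSchwingerDysonStateOn_of_isSDFunctionalOn` — transfer to any
  finite measure realising the functional on the polynomials;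
* ★★★ `eq_wilson_of_abelianBootstrap_u1` — `U(1)` on the torus `(ℤ/L)^d`, ANY real `β`: a linear
  functional which is normalised, square-positive on the polynomial observables (all moment matrices
  PSD) and satisfies the loop equations for the GAUGE-INVARIANT POLYNOMIAL test functions (Wilson
  loops and their products) gives every gauge-invariant polynomial observable its Wilson
  expectation — the untruncated abelian Wilson-loop bootstrap is exact;
* ★★ `exists_dlr_of_abelianBootstrap_u1` — `U(1)` on `ℤ^d`: such a functional agrees on the
  gauge-invariant polynomials with a DLR state (the gauge average of its realising measure).

What this is NOT: non-abelian (there the gauge-invariant rows along traceless directions are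
vacuous, gen 72); truncated (see `BootstrapConvergence.lean` for all-polynomial truncations).

References: Z. Li, S. Zhou, arXiv:2404.17071 §2, §4 ("whether loop equations + positivity are
strong enough to solve the abelian lattice gauge theories"); P. Anderson, M. Kruczenski, Nucl.
Phys. B 921 (2017). Folklore.
-/

noncomputable section

open MeasureTheory Filter Topology NormedSpace
open Literature.MathematicalPhysics.QuantumFieldTheory (haarProbability LatticeRep)

namespace Summit.QuantumFields.GaugeBoot

/-! ## Schwinger–Dyson functionals on a class of test functions -/

section General

variable {ι : Type*} [DecidableEq ι] [Countable ι] {G : Type*} [Group G] [TopologicalSpace G]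
  [IsTopologicalGroup G] [CompactSpace G] [MeasurableSpace G] [BorelSpace G]
  [SecondCountableTopology G] (r : LatticeRep G) {K : Type*}

/-- **Schwinger–Dyson functional on the class `Q`**: as `IsSDFunctional`, but the linear loop
equations `φ f' = β φ (f S_i')` are asked only for the polynomial test functions `f` with `Q f`
(e.g. `Q` = gauge invariance: Wilson loops and their products). [shape] A parametric definition of
a proposition — NOT a fact. [folklore] -/
def IsSDFunctionalOn (Q : ((ι → G) → ℝ) → Prop) (k : K → ℝ → G) (S : ι → (ι → G) → ℝ) (β : ℝ)
    (φ : C(ι → G, ℝ) →ₗ[ℝ] ℝ) : Prop :=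
  ∀ (i : ι) (a : K), ∃ S' ∈ polyAlgebra (ι := ι) r,
    (∀ U, HasDerivAt (fun t => S i (Function.update U i (k a t * U i))) (S' U) 0) ∧
      ∀ f ∈ polyAlgebra (ι := ι) r, Q f → ∀ f' ∈ polyAlgebra (ι := ι) r,
        (∀ U, HasDerivAt (fun t => f (Function.update U i (k a t * U i))) (f' U) 0) →
          φ f' = β * φ (f * S')

variable {k : K → ℝ → G} {X : K → Matrix (Fin r.N) (Fin r.N) ℂ} {S : ι → (ι → G) → ℝ} {β : ℝ}

omit [Countable ι] [IsTopologicalGroup G] [CompactSpace G] [MeasurableSpace G] [BorelSpace G]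
  [SecondCountableTopology G] in
/-- A Schwinger–Dyson functional (all polynomial test functions) is one on every class. -/
theorem IsSDFunctional.on {φ : C(ι → G, ℝ) →ₗ[ℝ] ℝ} (hφ : IsSDFunctional r k S β φ)
    (Q : ((ι → G) → ℝ) → Prop) : IsSDFunctionalOn r Q k S β φ := fun i a => by
  obtain ⟨S', hS'm, hS', hrows⟩ := hφ i a
  exact ⟨S', hS'm, hS', fun f hf _ => hrows f hf⟩

omit [Countable ι] [CompactSpace G] [BorelSpace G] [SecondCountableTopology G] in
/-- **Transfer to a realising measure.** If `φ` satisfies the loop equations for the polynomial test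
functions in the class `Q` and the finite measure `μ` realises `φ` on the polynomials, then `μ` is a
Schwinger–Dyson state on the class "polynomial and `Q`". [folklore] -/
theorem isSchwingerDysonStateOn_of_isSDFunctionalOn (hk : ∀ a s t, k a (s + t) = k a s * k a t)
    (hX : ∀ a t, r.ρ (k a t) = exp ((t : ℂ) • X a)) {Q : ((ι → G) → ℝ) → Prop}
    {φ : C(ι → G, ℝ) →ₗ[ℝ] ℝ} (hφ : IsSDFunctionalOn r Q k S β φ) (μ : Measure (ι → G))
    [IsFiniteMeasure μ] (hμ : ∀ a ∈ polyAlgebra (ι := ι) r, ∫ U, a U ∂μ = φ a) :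
    IsSchwingerDysonStateOn (fun f => f ∈ polyFunctions (ι := ι) r ∧ Q f) k S β μ := by
  intro i a
  obtain ⟨S', hS'm, hS', hrows⟩ := hφ i a
  refine ⟨S', S'.continuous, hS', fun f f' hf _ _ hf' => ?_⟩
  obtain ⟨f₀, hf₀, hf₀e⟩ := (mem_polyFunctions_iff r).1 hf.1
  obtain ⟨f₀', hf₀'m, hf₀'⟩ := exists_deriv_mem_polyAlgebra r (hk a) (hX a) i hf₀
  subst hf₀e
  have he : f' = ⇑f₀' := funext fun U => (hf' U).unique (hf₀' U)
  rw [he, hμ _ hf₀'m, hrows f₀ hf₀ hf.2 f₀' hf₀'m hf₀',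
    ← hμ _ ((polyAlgebra (ι := ι) r).mul_mem hf₀ hS'm)]
  rfl

end General

/-! ## `U(1)`: the Wilson-loop bootstrap is exact -/

section Abelian

open Literature.MathematicalPhysics.QuantumFieldTheory (Site Edge GaugeConfig gaugeTransform
  IsGaugeInvariant wilsonAction wilsonMeasure)
open Literature.MathematicalPhysics.QuantumLattice

variable {d L : ℕ}

/-- ★★★ **`U(1)` on the torus `(ℤ/L)^d`, ANY real `β`: the untruncated Wilson-loop bootstrap is
exact in the gauge-invariant sector.** A linear functional on the observables which is normalised,
square-positive on the polynomial observables, and satisfies the loop equations (all links, shifts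
`e^{tX}`, `X ∈ 𝔲(1)`) for the GAUGE-INVARIANT POLYNOMIAL test functions gives every gauge-invariant
polynomial observable its Wilson expectation. No realisability hypothesis. [folklore] -/
theorem eq_wilson_of_abelianBootstrap_u1 [NeZero L] (β : ℝ)
    {φ : C(GaugeConfig d L (Matrix.unitaryGroup (Fin 1) ℂ), ℝ) →ₗ[ℝ] ℝ} (h1 : φ 1 = 1)
    (hpos : ∀ a ∈ polyAlgebra (ι := Edge d L) (unitaryFundamentalLatticeRep 1), 0 ≤ φ (a * a))
    (hφ : IsSDFunctionalOn (unitaryFundamentalLatticeRep 1) IsGaugeInvariant (uExp 1)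
      (fun _ => wilsonAction (unitaryFundamentalRep (Fin 1) ℂ)) β φ)
    {a : C(GaugeConfig d L (Matrix.unitaryGroup (Fin 1) ℂ), ℝ)}
    (ha : a ∈ polyAlgebra (ι := Edge d L) (unitaryFundamentalLatticeRep 1))
    (hai : IsGaugeInvariant (⇑a)) :
    φ a = ∫ U, a U ∂(wilsonMeasure (unitaryFundamentalRep (Fin 1) ℂ) β) := by
  obtain ⟨μ, hμ, hμA⟩ := exists_probabilityMeasure_of_sqPositive_poly (unitaryFundamentalLatticeRep 1)
    h1 hpos
  have hsd := isSchwingerDysonStateOn_of_isSDFunctionalOn (unitaryFundamentalLatticeRep 1)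
    (uExp_add 1) (X := fun X : UGenerator 1 => (X : Matrix (Fin 1) (Fin 1) ℂ)) (rho_uExp 1) hφ μ hμA
  rw [← hμA a ha]
  exact integral_eq_wilson_of_sdOn_gaugeInvariantPoly_u1 hsd (⇑a) a.continuous hai

/-- **Conversely** the Wilson expectation solves the abelian Wilson-loop bootstrap (it solves the
all-polynomial one, `bootstrap_wilson_suN`-style). [folklore] -/
theorem abelianBootstrap_wilson_u1 [NeZero L] (β : ℝ)
    (μ : Measure (GaugeConfig d L (Matrix.unitaryGroup (Fin 1) ℂ))) [IsProbabilityMeasure μ]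
    (hμ : μ = wilsonMeasure (unitaryFundamentalRep (Fin 1) ℂ) β) :
    expectationFunctional μ 1 = 1 ∧
      (∀ a : C(GaugeConfig d L (Matrix.unitaryGroup (Fin 1) ℂ), ℝ),
        0 ≤ expectationFunctional μ (a * a)) ∧
      IsSDFunctionalOn (unitaryFundamentalLatticeRep 1) IsGaugeInvariant (uExp 1)
        (fun _ => wilsonAction (unitaryFundamentalRep (Fin 1) ℂ)) β (expectationFunctional μ) :=
  ⟨expectationFunctional_one _, expectationFunctional_sq_nonneg _,
    (isSDFunctional_expectationFunctional (unitaryFundamentalLatticeRep 1) (uExp_add 1)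
      (X := fun X : UGenerator 1 => (X : Matrix (Fin 1) (Fin 1) ℂ)) (rho_uExp 1)
      (fun _ => wilsonAction_mem_polyFunctions (unitaryFundamentalLatticeRep 1)) _
      ((eq_wilsonMeasure_iff_polySD_uN 1 β μ).1 hμ)).on _ _⟩

/-- ★★ **`U(1)` on `ℤ^d`: a solution of the untruncated Wilson-loop bootstrap agrees on the
gauge-invariant polynomial observables with a DLR state** (the gauge average of its realising
measure). [folklore] -/
theorem exists_dlr_of_abelianBootstrap_u1 (β : ℝ)
    {φ : C(LGConfig d (Matrix.unitaryGroup (Fin 1) ℂ), ℝ) →ₗ[ℝ] ℝ} (h1 : φ 1 = 1)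
    (hpos : ∀ a ∈ polyAlgebra (ι := ZdEdge d) (unitaryFundamentalLatticeRep 1), 0 ≤ φ (a * a))
    (hφ : IsSDFunctionalOn (unitaryFundamentalLatticeRep 1) IsZdGaugeInvariant (uExp 1)
      (fun e => wilsonBoundaryAction (unitaryFundamentalRep (Fin 1) ℂ) {e}) β φ) :
    ∃ ν ∈ ymGibbsMeasures (d := d) (unitaryFundamentalRep (Fin 1) ℂ) β,
      ∀ a ∈ polyAlgebra (ι := ZdEdge d) (unitaryFundamentalLatticeRep 1), IsZdGaugeInvariant (⇑a) →
        φ a = ∫ U, a U ∂ν := by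
  obtain ⟨μ, hμ, hμA⟩ := exists_probabilityMeasure_of_sqPositive_poly (unitaryFundamentalLatticeRep 1)
    h1 hpos
  have hsd := isSchwingerDysonStateOn_of_isSDFunctionalOn (unitaryFundamentalLatticeRep 1)
    (uExp_add 1) (X := fun X : UGenerator 1 => (X : Matrix (Fin 1) (Fin 1) ℂ)) (rho_uExp 1) hφ μ hμA
  refine ⟨avgMeasure (gaugeTransformZd (d := d) (G := Matrix.unitaryGroup (Fin 1) ℂ)) μ,
    avgMeasure_mem_ymGibbsMeasures_of_sdOn_gaugeInvariantPoly_u1 hsd, fun a ha hai => ?_⟩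
  rw [← hμA a ha, integral_avgMeasure_of_invariant gaugeTransformZd_action.2 a.continuous hai μ]

end Abelian

end Summit.QuantumFields.GaugeBoot

end
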